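import Literature.IUT.LogThetaLattice.LogThetaLatticeCoricityProofs
import Literature.IUT.LogThetaLattice.StripFrameWitness
import HarnessLib

/-!
# [IUTchII] Corollary 4.10 (iv): the typed coricity statement `HodgeTheaterStrips.UnitMuCoric` is a SCHEMA — universal-closure certificate (proofs only)

S. Mochizuki, *Inter-universal Teichmüller theory II*, kurims manuscript, §4, Corollary 4.10 (iv) p. 160 ("`(−)F^{⊢×μ}_△` is an
invariant of both the `Θ^{×μ}`- and `Θ^{×μ}_{gau}`-links") [claim: Mochizuki2012, status: disputed] (D-0012 claim key; the content proved here
is elementary). abc-iut cell, block F (seat abc-iut-f-130 gen 7; director-abc g4 row supply `ROWS-LF-0348.tsv` «decide the label»);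
frozen FACT-LIST row **F-2065** `HodgeTheaterStrips.UnitMuCoric` (`ThetaGauLinks.lean`). PROOF-ONLY (no `def`, no `instance`; nothing of the
statement file is re-typed); witnesses built inside the theorem terms from abc-iut-L6-t3's witness frame `Witness.twoFrame`
(`StripFrameWitness.lean`) and the owner-side equivalence `unitMuCoric_iff_map_full` (`LogThetaLatticeCoricityProofs.lean`).

The predicate is typed over a FREE four-category setting (`ThetaLinkSetting FV FVM FUM DM`) and free strips; its content is «the functor
`F^{⊩▶×μ} ↦ F^{⊢×μ}` carries the full poly-isomorphisms onto the full poly-isomorphism» (`unitMuCoric_of_mapIso_surjective` /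
`unitMuCoric_iff_map_full`). Hence the universal closure is FALSE at a setting where that functor is not full on isomorphisms:

* `not_forall_unitMuCoric` — at the frame `{twoFrame with F^{⊩▶×μ} := Discrete PUnit}` (one object, one isomorphism) mapped constantly
  into `F^{⊢×μ} := Pt` (one object, automorphisms `±1`), with all strips `pt` and all structure isomorphisms identities, the image of the
  full poly-isomorphism is `{𝟙} ∌ −1`;
* `exists_unitMuCoric` — at `twoFrame` itself (`F^{⊩▶×μ} ↦ F^{⊢×μ}` is the identity of `Pt`, fully faithful) the statement HOLDS.

HONEST FRAMING: a refuted universal closure is a statement about OUR typing (the four-category signature is free), not about the printed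
corollary, where `F^{⊩▶×μ} ↦ F^{⊢×μ}` is Def. 4.9 (vi)–(viii)'s "pass to isometries / quotients by torsion" and the instance-form theorems
apply (`unitMuCoric_of_thetaMonoidData`, `unitMuCoric_of_thetaLinkData`, `unitMuCoric_all_of_thetaLinkData`). Nothing here bears on
[IUTchIII] Cor. 3.12 or takes a side; typed ≠ proved; nothing asserts abc proved or refuted.
-/

noncomputable section

namespace Literature.IUT.LogThetaLattice

open CategoryTheory Literature.IUT.HodgeTheaters Literature.IUT.HodgeArakelov Witness

/-- **F-2065 is a schema**: the universal closure of `HodgeTheaterStrips.UnitMuCoric` (over all four-category link settings and all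
pairs of strips) is FALSE — witness: the frame `twoFrame` with `F^{⊩▶×μ}` replaced by the terminal groupoid, whose functor to
`F^{⊢×μ} = Pt` misses the automorphism `−1`. [claim: Mochizuki2012, status: disputed] (IUTchII §4 Cor 4.10 (iv), kurims p.160) -/
theorem not_forall_unitMuCoric :
    ¬ ∀ (FV : Type) [Category.{0} FV] (FVM : Type) [Category.{0} FVM] (FUM : Type) [Category.{0} FUM]
        (DM : Type) [Category.{0} DM] (S : ThetaLinkSetting FV FVM FUM DM) (dag ddag : HodgeTheaterStrips S),
        dag.UnitMuCoric ddag := by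
  intro h
  let S' : StripFrame.{0} :=
    { twoFrame with
      Fglxm := Discrete PUnit
      catFglxm := inferInstance
      grpFglxm := inferInstance
      FglToFglxm := (Functor.const _).obj ⟨PUnit.unit⟩
      FglxmToFvtxm := toPt _
      iso_nonempty_Fglxm := fun X Y => ⟨eqToIso (Subsingleton.elim X Y)⟩ }
  let dag : HodgeTheaterStrips (ThetaLinkSetting.ofStripFrame S') :=
    { delta := pt, fmod := pt, env := pt, tht := pt, gau := pt,
      deltaIsoMod := Iso.refl _, envIsoTht := Iso.refl _, evalIso := Iso.refl _,
      unitDeltaIsoEnv := Iso.refl _, unitEnvIsoGau := Iso.refl _ }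
  have hfull := ((unitMuCoric_iff_map_full dag dag).mp (h _ _ _ _ _ dag dag)).1
  have hmem : (negIso : S'.FglxmToFxm.obj (S'.FglToFglxm.obj dag.env) ≅ S'.FglxmToFxm.obj (S'.FglToFglxm.obj dag.delta)) ∈
      (PolyIso.full (S'.FglToFglxm.obj dag.env) (S'.FglToFglxm.obj dag.delta)).map S'.FglxmToFxm := by
    rw [hfull]; exact Set.mem_univ _
  obtain ⟨f, -, hf⟩ := hmem
  have hhom := congrArg Iso.hom hf
  rw [negIso_hom] at hhom
  -- the constant functor sends every morphism to the identity `1 : ℤˣ`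
  change (1 : ℤˣ) = -1 at hhom
  exact absurd hhom (by decide)

/-- **F-2065, INHABITED**: at the witness frame `twoFrame` (every structure functor the identity of `Pt`) the coricity statement holds
for the all-`pt` strips (`PolyIso.map_full_of_fullyFaithful`, via `unitMuCoric_iff_map_full`).
[claim: Mochizuki2012, status: disputed] (IUTchII §4 Cor 4.10 (iv), kurims p.160) -/
theorem exists_unitMuCoric :
    ∃ (FV : Type) (_ : Category.{0} FV) (FVM : Type) (_ : Category.{0} FVM) (FUM : Type) (_ : Category.{0} FUM)
        (DM : Type) (_ : Category.{0} DM) (S : ThetaLinkSetting FV FVM FUM DM) (dag ddag : HodgeTheaterStrips S),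
        dag.UnitMuCoric ddag := by
  let dag : HodgeTheaterStrips (ThetaLinkSetting.ofStripFrame twoFrame) :=
    { delta := pt, fmod := pt, env := pt, tht := pt, gau := pt,
      deltaIsoMod := Iso.refl _, envIsoTht := Iso.refl _, evalIso := Iso.refl _,
      unitDeltaIsoEnv := Iso.refl _, unitEnvIsoGau := Iso.refl _ }
  refine ⟨_, inferInstance, _, inferInstance, _, inferInstance, _, inferInstance, _, dag, dag, ?_⟩
  exact (unitMuCoric_iff_map_full dag dag).mpr
    ⟨PolyIso.map_full_of_fullyFaithful (Functor.FullyFaithful.id Pt) _ _,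
      PolyIso.map_full_of_fullyFaithful (Functor.FullyFaithful.id Pt) _ _⟩

end Literature.IUT.LogThetaLattice

end
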